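import Summits.QuantumFields.YangMills.Theorems.UnitScaleTiltProp7SectET3RealityPInvJTermT3
import Summits.QuantumFields.YangMills.Theorems.UnitScaleTiltProp7WilsonHessianSectorRows
import Summits.QuantumFields.YangMills.Theorems.UnitScaleTiltProp7SectET3JcurReality
import Summits.QuantumFields.YangMills.Theorems.UnitScaleTiltProp7Crit93OfEq111T3
import HarnessLib

/-!
# Route `UnitScaleTilt`, crux «MinimiserStabilityRegPr» (stmt-QuantumFields-19200, stub EX `stub_existenceMinimalOrbit`, route (α)) — «HXTR-ETA-TJ»: **THE TRACELESS-RESIDUAL ROW `hXtr` OF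
# ✓`Prop7Eq128AtMemberOfCrit127(TwoSlot)` (p677812 ∕ p678896) AT THE S11 OPERATOR SLOT `Δ_x := Δ^η + T_Jᴾ`** — the residual `Δ_x U₀ (toL2 Yf) + funEquiv⁻¹(NegSup.equiv (Jcur (bgOfCfg U₀)) + NegSup.equiv Wv)`
# is traceless bond by bond whenever the field `Yf` and the `(δ∕δA′)V`-datum `Wv` are, at `U₀ ∈ 𝔘_k(ε₀)`: `Δ^η` preserves traceless (✓`Prop7WilsonHessianSectorRows.trace_DeltaEta_toL2_eq_zero`), so does
# `T_Jᴾ` (✓`Prop7SectET3RealityPInvJTerm.TJP_rows_at_regPr`), and the current `J` of an `SU(2)` background is traceless (✓`Prop7SectET3JcurReality.isHermitian_trace_zero_Jcur_bgOfCfg`).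

Cell `ym3-torus` (HUMAN RULING D-0037, YM ladder rung R3 — YM₃ on T³, NOT d = 4, NOT Clay; YM gap NOT proved), width seat `ym3-torus-px21` gen 3 (explicit-unit helper; lineage px21 g0∕g2∕g3;
EX namer ★w2-19200 g7 SLOT WORD `(Δ_L, Δ_x) = (Δ₁ᴾ, Δ^η + T_Jᴾ)`).  THEOREMS ONLY (0 `def`, 0 `sorry`); `--supports stmt-QuantumFields-19200 --as helper`, count-neutral; NO claim on crux ∕ stub ∕ registry.

THE PRINT.  [Balaban1985Variational] (51) p. 286 (all chart fields are `𝔤 = 𝔰𝔲(2)`-valued), (27)–(28) p. 282 (the current `J`), (128) p. 297 (the residual); [Balaban1985BackgroundPropagators] (3.10)–(3.15)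
pp. 392–393 (`Δ^η` on `𝔤`-valued fields), (3.127)–(3.128) p. 421 (the J-term).  In print tracelessness is automatic; on the tree's `M₂(ℂ)`-valued carriers it is the row `hXtr` that lets
✓`exists_eq_adjoint_Qk_of_hermitian_traceless` pass from the `𝔰𝔲(2)` directions of `hCrit127` to all of `ker Q_k`.
WHAT IS PROVED (member `F`, `K n`, `h : n ≤ K`, weights `c₀ cB`, `0 ≤ a`; ns `…Theorems.Prop7TracelessResidualEtaTJ`):
* §1 `trace_funEquiv_symm_negSup_add` — `tr ((toL2)⁻¹(funEquiv⁻¹(NegSup.equiv J + NegSup.equiv W)) b) = tr (J♭ b) + tr (W♭ b)` (✓`funEquiv_symm_eq_toL2'`).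
* §2 ★★ `trace_DeltaEtaTJ_toL2_eq_zero` — the SLOT ROW `hΔxtr` («traceless `A` ⇒ traceless `toL2⁻¹(Δ_x U₀ (toL2 A))`», ★px16 g3 LOCATE-H128-FAMILY §4) at `Δ_x := (DeltaEtaSlot … + TJSlotP …) U₀`.
* §3 ★★★ `trace_residual_eq_zero_etaTJ` — at `U₀ ∈ 𝔘_k(ε₀)` (`10⁹L²e ≤ 1`, `10¹²L³ε₀ ≤ 1`): traceless `Yf`, traceless `Wv` ⟹ the residual at `Δ_x := (DeltaEtaSlot … + TJSlotP …) U₀` is traceless —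
  the `hXtr` row of ✓`exists_eq_adjoint_Qk_of_hCrit127_of_hasDerivAt_actionZ_twoSlot` at the S11 slot (`Yf := ιA₁ + ι(H₁f(Δ_L) B̃)` traceless by `h𝒢R`∕`hH₁R`-class reality, `Wv := Wf L i U₀ (…)`
  traceless by `hWR`); `trace_residual_eq_zero_etaTJ'` — the same with the slot written `DeltaEtaSlot … U₀ + TJSlotP … U₀` (`Pi.add_apply`).
HONEST SCOPE.  Bookkeeping over landed reality rows; no estimate; not a proof of any stub; nothing continuum ∕ OS ∕ mass-gap ∕ Clay.
-/

set_option autoImplicit false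

noncomputable section

open scoped Matrix.Norms.L2Operator BigOperators

namespace Summit.QuantumFields.YangMills.Theorems.Prop7TracelessResidualEtaTJ

open Literature.MathematicalPhysics.QuantumFieldTheory.Balaban1983to89
open Literature.MathematicalPhysics.QuantumFieldTheory.Balaban1983to89.T3ContinuumYM3Torus
open T3PrintedRegularMinimiser (RegPr)
open B9SectCLatticeCarrier (Bond)
open B11Eq115Space (NegSize NegSup levWeight)
open B11Eq103H1Complex (BondL2K funEquiv)
open B11Eq98CurrentSlot (Jcur)
open Summit.QuantumFields.YangMills.Theorems.Prop7SectET3Transport (periodsT3 bondEquiv bgOfCfg)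
open Summit.QuantumFields.YangMills.Theorems.Prop7SectET3HilbertLetters (W₂ frobEquiv toL2)
open Summit.QuantumFields.YangMills.Theorems.Prop7SectET3DeltaOnePInv (TJP TJSlotP TJSlotP_apply)
open Summit.QuantumFields.YangMills.Theorems.Prop7SectET3RealityPInvJTerm (TJP_rows_at_regPr)
open Summit.QuantumFields.YangMills.Theorems.Prop7SectET3WilsonHessian (DeltaEta DeltaEtaSlot DeltaEtaSlot_apply)
open Summit.QuantumFields.YangMills.Theorems.Prop7WilsonHessianSectorRows (trace_DeltaEta_toL2_eq_zero)
open Summit.QuantumFields.YangMills.Theorems.Prop7SectET3JcurReality (isHermitian_trace_zero_Jcur_bgOfCfg)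
open Summit.QuantumFields.YangMills.Theorems.Prop7Crit93OfEq111 (funEquiv_symm_eq_toL2')

variable {F : T3Family} {n K : ℕ} {h : n ≤ K} {c₀ cB a : ℝ} [Fact (0 < c₀)] [Fact (0 < cB)]
variable [Fact (0 < (F.L : ℝ))] [Fact (0 < ((F.L : ℝ)⁻¹) ^ (K - n))]

/-! ## §1 The `(−3)`-data half of the residual, bond by bond -/

omit [Fact (0 < c₀)] [Fact (0 < cB)] [Fact (0 < (F.L : ℝ))] [Fact (0 < ((F.L : ℝ)⁻¹) ^ (K - n))] in
/-- `tr ((toL2)⁻¹(funEquiv⁻¹(NegSup.equiv J + NegSup.equiv W)) b) = tr (J♭ b) + tr (W♭ b)` — the `(−3)`-carrier read back on the route's bonds (✓`funEquiv_symm_eq_toL2'`).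
[cite: Balaban1985Variational, (27) p.282; Balaban1985BackgroundPropagators, (3.11) p.392] -/
theorem trace_funEquiv_symm_negSup_add (J W : NegSize (F.L : ℝ) (((F.L : ℝ)⁻¹) ^ (K - n)) (fun _ : Bond 3 (periodsT3 F K) => K - n) 3 (Matrix (Fin 2) (Fin 2) ℂ))
    (b : PBond (F.P K) 0) :
    Matrix.trace ((toL2 F K c₀).symm ((funEquiv frobEquiv (fun _ : Bond 3 (periodsT3 F K) => c₀)).symm (NegSup.equiv _ _ J + NegSup.equiv _ _ W)) b)
      = Matrix.trace (NegSup.equiv _ _ J (bondEquiv F K b)) + Matrix.trace (NegSup.equiv _ _ W (bondEquiv F K b)) := by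
  rw [funEquiv_symm_eq_toL2', LinearEquiv.symm_apply_apply, Pi.add_apply, Matrix.trace_add]

/-! ## §2 The slot row `hΔxtr` at `Δ_x := Δ^η + T_Jᴾ`: the operator preserves traceless fields -/

/-- ★★ **THE SLOT ROW `hΔxtr` AT `Δ_x := (DeltaEtaSlot … + TJSlotP …) U₀`** (★px16 g3's family-door row «traceless `A` ⇒ traceless `toL2⁻¹(Δx U₀ (toL2 A))`», LOCATE-H128-FAMILY §4) at
`U₀ ∈ 𝔘_k(ε₀)` (`10⁹L²e ≤ 1`, `10¹²L³ε₀ ≤ 1`, `0 ≤ a`): ✓`trace_DeltaEta_toL2_eq_zero` + ✓`TJP_rows_at_regPr`.2.1.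
[cite: Balaban1985Variational, (51) p.286; Balaban1985BackgroundPropagators, (3.10)–(3.15) pp.392–393, (3.127)–(3.128) p.421] -/
theorem trace_DeltaEtaTJ_toL2_eq_zero (ha : 0 ≤ a) {ε₀ e : ℝ} (hε₀ : 0 < ε₀) (he : 0 < e) (hWe : 10 ^ 9 * (F.L : ℝ) ^ 2 * e ≤ 1) (hWε : 10 ^ 12 * (F.L : ℝ) ^ 3 * ε₀ ≤ 1)
    (U₀ : GaugeField (F.P K) 0 (Matrix.specialUnitaryGroup (Fin 2) ℂ)) (hreg : RegPr F n K ε₀ U₀) :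
    ∀ A : PBond (F.P K) 0 → Matrix (Fin 2) (Fin 2) ℂ, (∀ b, Matrix.trace (A b) = 0) →
      ∀ b : PBond (F.P K) 0, Matrix.trace ((toL2 F K c₀).symm ((DeltaEtaSlot F n K c₀ + TJSlotP F n K h c₀ cB a) U₀ (toL2 F K c₀ A)) b) = 0 := by
  intro A hA b
  have hT := (TJP_rows_at_regPr F n K h c₀ cB a U₀ ha hε₀ he hWe hWε hreg).2.1 A hA b
  have hΔ := trace_DeltaEta_toL2_eq_zero (n := n) (c₀ := c₀) U₀ A hA b
  rw [Pi.add_apply, LinearMap.add_apply, map_add, Pi.add_apply, Matrix.trace_add, DeltaEtaSlot_apply, TJSlotP_apply, hΔ, hT, add_zero]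

/-! ## §3 ★★★ The residual at `Δ_x := Δ^η + T_Jᴾ` is traceless -/

/-- ★★★ **THE `hXtr` ROW AT THE S11 OPERATOR SLOT `Δ_x := (DeltaEtaSlot … + TJSlotP …) U₀`** (the Pi-sum letter of ⧗∕✓`Prop7HDsolAtRecordOfRowsTwoSlotFamily`): at `U₀ ∈ 𝔘_k(ε₀)` in the windows
`10⁹L²e ≤ 1`, `10¹²L³ε₀ ≤ 1`, `0 ≤ a`, for a traceless route field `Yf` and a traceless `(−3)`-datum `Wv`, every bond value of
`(toL2)⁻¹(Δ_x U₀ (toL2 Yf) + funEquiv⁻¹(NegSup.equiv (Jcur (bgOfCfg U₀)) + NegSup.equiv Wv))` is traceless (✓`trace_DeltaEta_toL2_eq_zero` + ✓`TJP_rows_at_regPr` + ✓`isHermitian_trace_zero_Jcur_bgOfCfg`).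
[cite: Balaban1985Variational, (51) p.286, (27)–(28) p.282, (128) p.297; Balaban1985BackgroundPropagators, (3.10)–(3.15) pp.392–393, (3.127)–(3.128) p.421] -/
theorem trace_residual_eq_zero_etaTJ (ha : 0 ≤ a) {ε₀ e : ℝ} (hε₀ : 0 < ε₀) (he : 0 < e) (hWe : 10 ^ 9 * (F.L : ℝ) ^ 2 * e ≤ 1) (hWε : 10 ^ 12 * (F.L : ℝ) ^ 3 * ε₀ ≤ 1)
    (U₀ : GaugeField (F.P K) 0 (Matrix.specialUnitaryGroup (Fin 2) ℂ)) (hreg : RegPr F n K ε₀ U₀)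
    (Yf : PBond (F.P K) 0 → Matrix (Fin 2) (Fin 2) ℂ) (hYtr : ∀ b, Matrix.trace (Yf b) = 0)
    (Wv : NegSize (F.L : ℝ) (((F.L : ℝ)⁻¹) ^ (K - n)) (fun _ : Bond 3 (periodsT3 F K) => K - n) 3 (Matrix (Fin 2) (Fin 2) ℂ))
    (hWtr : ∀ b : Bond 3 (periodsT3 F K), Matrix.trace (NegSup.equiv _ _ Wv b) = 0) :
    ∀ b : PBond (F.P K) 0, Matrix.trace ((toL2 F K c₀).symm
      ((DeltaEtaSlot F n K c₀ + TJSlotP F n K h c₀ cB a) U₀ (toL2 F K c₀ Yf)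
        + (funEquiv frobEquiv (fun _ : Bond 3 (periodsT3 F K) => c₀)).symm
            (NegSup.equiv _ _ (Jcur (L := (F.L : ℝ)) (η := ((F.L : ℝ)⁻¹) ^ (K - n)) (lev₀ := fun _ : Bond 3 (periodsT3 F K) => K - n) (bgOfCfg F K U₀))
              + NegSup.equiv _ _ Wv)) b) = 0 := by
  intro b
  have hΔT := trace_DeltaEtaTJ_toL2_eq_zero (h := h) (c₀ := c₀) (cB := cB) ha hε₀ he hWe hWε U₀ hreg Yf hYtr b
  have hJ := (isHermitian_trace_zero_Jcur_bgOfCfg (n := n) U₀ (bondEquiv F K b)).2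
  rw [map_add, Pi.add_apply, Matrix.trace_add, trace_funEquiv_symm_negSup_add, hJ, hWtr, add_zero, add_zero, hΔT]

/-- ★★ **THE SAME WITH THE SLOT WRITTEN `DeltaEtaSlot … U₀ + TJSlotP … U₀`** (the letter of ✓`Prop7Row84AtEtaSlotMember` ∕ the SLOT WORD's `fun U₀ ↦ …`; `Pi.add_apply`).
[cite: Balaban1985Variational, (51) p.286, (128) p.297; Balaban1985BackgroundPropagators, (3.127)–(3.128) p.421] -/
theorem trace_residual_eq_zero_etaTJ' (ha : 0 ≤ a) {ε₀ e : ℝ} (hε₀ : 0 < ε₀) (he : 0 < e) (hWe : 10 ^ 9 * (F.L : ℝ) ^ 2 * e ≤ 1) (hWε : 10 ^ 12 * (F.L : ℝ) ^ 3 * ε₀ ≤ 1)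
    (U₀ : GaugeField (F.P K) 0 (Matrix.specialUnitaryGroup (Fin 2) ℂ)) (hreg : RegPr F n K ε₀ U₀)
    (Yf : PBond (F.P K) 0 → Matrix (Fin 2) (Fin 2) ℂ) (hYtr : ∀ b, Matrix.trace (Yf b) = 0)
    (Wv : NegSize (F.L : ℝ) (((F.L : ℝ)⁻¹) ^ (K - n)) (fun _ : Bond 3 (periodsT3 F K) => K - n) 3 (Matrix (Fin 2) (Fin 2) ℂ))
    (hWtr : ∀ b : Bond 3 (periodsT3 F K), Matrix.trace (NegSup.equiv _ _ Wv b) = 0) :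
    ∀ b : PBond (F.P K) 0, Matrix.trace ((toL2 F K c₀).symm
      ((DeltaEtaSlot F n K c₀ U₀ + TJSlotP F n K h c₀ cB a U₀) (toL2 F K c₀ Yf)
        + (funEquiv frobEquiv (fun _ : Bond 3 (periodsT3 F K) => c₀)).symm
            (NegSup.equiv _ _ (Jcur (L := (F.L : ℝ)) (η := ((F.L : ℝ)⁻¹) ^ (K - n)) (lev₀ := fun _ : Bond 3 (periodsT3 F K) => K - n) (bgOfCfg F K U₀))
              + NegSup.equiv _ _ Wv)) b) = 0 := by
  have key := trace_residual_eq_zero_etaTJ (h := h) (c₀ := c₀) (cB := cB) ha hε₀ he hWe hWε U₀ hreg Yf hYtr Wv hWtr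
  intro b
  rw [← Pi.add_apply (DeltaEtaSlot F n K c₀) (TJSlotP F n K h c₀ cB a) U₀]
  exact key b

end Summit.QuantumFields.YangMills.Theorems.Prop7TracelessResidualEtaTJ

end
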